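import Literature.NumberTheory.Automorphic.ModularLambdaRootCompetitor
import Literature.Analysis.Complex.RootsOfUnityComplementAdmissibleFamily
import Literature.Analysis.Complex.InjectiveHolomorphic
import HarnessLib

/-!
# CDT Proposition 3.0.1, algebraization: holomorphic local sections of the uniformizer `x̂ = 16^{1/N}(λ/16)^{1/N}`

`Literature/Analysis/Complex/RootsOfUnityComplementLocalSections.lean` — PROOF-ONLY (no definition, no
named fact). First half of brick B5-α2 of the crux memo `Lines/cdt_thm1-core-map-g39.md` (K★ 22226), the
concrete input of `exists_holomorphic_extension_of_local_root_systems`: F. Calegari, V. Dimitrov, Y. Tang,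
J. Amer. Math. Soc. 38 (2025), proof of Proposition 3.0.1 and Remark 3.0.2 — the uniformizer
`x = (λ/16)^{1/N} : ℍ → ℂ^× ∖ 16^{-1/N}μ_N` is a holomorphic covering map, so (rescaled by `16^{1/N}` to
land in `ℂ ∖ μ_N`, the target of `F_N`) it has HOLOMORPHIC LOCAL SECTIONS through every point of `ℍ`
(`exists_local_section_rpow_mul_modularLambdaRoot`: tree `isLocalHomeomorph_modularLambdaRoot`,
injectivity on a neighbourhood ⇒ non-vanishing derivative ⇒ analytic local inverse), is onto
`{w | w ≠ 0, wᴺ ≠ 1}` (`exists_rpow_mul_modularLambdaRoot_eq`), and its fibres are the `Λ_N`-orbits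
(`exists_deck_smul_eq_of_rpow_mul_modularLambdaRoot_eq`); also `τ ↦ h(t • τ)` is holomorphic for
`t ∈ SL(2, ℤ)` (`mdifferentiable_comp_sl_smul`). The root systems themselves (R1, R3, R4 of the memo)
follow in the sequel file.

## References
* [CalegariDimitrovTang2025] F. Calegari, V. Dimitrov, Y. Tang, J. Amer. Math. Soc. 38 (2025), proof of
  Proposition 3.0.1 and Remark 3.0.2 (arXiv v1 Proposition 15, Remark 16).
-/

noncomputable section

open Complex Real Filter Topology Function Metric Set
open UpperHalfPlane hiding I
open scoped Real Topology Manifold MatrixGroups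

namespace Literature.Analysis.Complex

open _root_.Complex Literature.NumberTheory.Automorphic Literature.NumberTheory.Automorphic.ModularLambda
  ModularGroup

/-! ### §1 Holomorphy of `τ ↦ h(t • τ)` and the rescaled uniformizer -/

/-- `τ ↦ h (t • τ)` is holomorphic on `ℍ` for `t ∈ SL(2, ℤ)` when `h` is (a private copy of
`ModularLambda.mdifferentiable_comp_smul` of `GaloisConjugateGroup.lean`, whose module has no hub olean
at the time of writing). [cite: CalegariDimitrovTang2025, §4.2 (the action on modular functions)] -/
private theorem mdifferentiable_comp_sl_smul {h : ℍ → ℂ} (hh : MDiff h) (t : SL(2, ℤ)) :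
    MDiff fun τ : ℍ ↦ h (t • τ) := by
  have e : (fun τ : ℍ ↦ t • τ) = fun τ ↦ ((t : GL (Fin 2) ℝ)) • τ := by funext τ; rfl
  have hs : MDiff (fun τ : ℍ ↦ t • τ) := by
    rw [e]; exact UpperHalfPlane.mdifferentiable_smul (by simp)
  exact hh.comp hs

/-- The rescaled uniformizer `x̂ = 16^{1/N} x` is onto `{w | w ≠ 0 ∧ wᴺ ≠ 1}`.
[cite: CalegariDimitrovTang2025, §3 proof of Prop. 3.0.1] -/
theorem exists_rpow_mul_modularLambdaRoot_eq {N : ℕ} (hN : N ≠ 0) {w : ℂ} (hw0 : w ≠ 0)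
    (hw1 : w ^ N ≠ 1) :
    ∃ τ : ℍ, (((16 : ℝ) ^ ((N : ℝ)⁻¹) : ℝ) : ℂ) * modularLambdaRoot N τ = w := by
  set c : ℂ := (((16 : ℝ) ^ ((N : ℝ)⁻¹) : ℝ) : ℂ) with hc
  have hN0 : (N : ℝ) ≠ 0 := by exact_mod_cast hN
  have hcN : c ^ N = 16 := by
    rw [hc]
    have hrN : ((16 : ℝ) ^ ((N : ℝ)⁻¹)) ^ N = 16 := by
      rw [← Real.rpow_natCast, ← Real.rpow_mul (by norm_num), inv_mul_cancel₀ hN0, Real.rpow_one]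
    exact_mod_cast hrN
  have hc0 : c ≠ 0 := by
    intro h0; rw [h0, zero_pow hN] at hcN; norm_num at hcN
  have hu0 : w / c ≠ 0 := div_ne_zero hw0 hc0
  have hu1 : 16 * (w / c) ^ N ≠ 1 := by
    rw [div_pow, hcN]; field_simp; simpa using hw1
  obtain ⟨τ, hτ⟩ := exists_modularLambdaRoot_eq hN hu0 hu1
  exact ⟨τ, by rw [hτ]; field_simp⟩

/-- Fibres of the rescaled uniformizer: `x̂ τ₁ = x̂ τ₂ ⇒ τ₁ = γ • τ₂` for some `γ ∈ Λ_N`.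
[cite: CalegariDimitrovTang2025, §3 proof of Prop. 3.0.1] -/
theorem exists_deck_smul_eq_of_rpow_mul_modularLambdaRoot_eq {N : ℕ} (hN : N ≠ 0) {τ₁ τ₂ : ℍ}
    (h : (((16 : ℝ) ^ ((N : ℝ)⁻¹) : ℝ) : ℂ) * modularLambdaRoot N τ₁ =
      (((16 : ℝ) ^ ((N : ℝ)⁻¹) : ℝ) : ℂ) * modularLambdaRoot N τ₂) :
    ∃ γ ∈ modularLambdaRootDeck N, γ • τ₂ = τ₁ := by
  have hc0 : (((16 : ℝ) ^ ((N : ℝ)⁻¹) : ℝ) : ℂ) ≠ 0 := by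
    exact_mod_cast (by positivity : (0 : ℝ) < (16 : ℝ) ^ ((N : ℝ)⁻¹)).ne'
  have h' : modularLambdaRoot N τ₂ = modularLambdaRoot N τ₁ := (mul_left_cancel₀ hc0 h).symm
  exact (modularLambdaRoot_eq_modularLambdaRoot_iff hN).mp h'

/-! ### §2 Local holomorphic sections of the rescaled uniformizer (R2) -/

/-- **A holomorphic local section of `x̂ = 16^{1/N} x` through a given point of `ℍ`.** For
`τ₀ ∈ ℍ` there are `ε > 0` and `ψ₀` holomorphic on `B(x̂ τ₀, ε)` with `ψ₀(x̂ τ₀) = τ₀`, values in the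
upper half plane, and `x̂(ψ₀(w)) = w` (the uniformizer is a holomorphic covering map, in particular a
local biholomorphism: tree `isLocalHomeomorph_modularLambdaRoot`, injectivity on a neighbourhood, and
the holomorphic inverse function theorem). [cite: CalegariDimitrovTang2025, §3 proof of Prop. 3.0.1] -/
theorem exists_local_section_rpow_mul_modularLambdaRoot {N : ℕ} (hN : N ≠ 0) (τ₀ : ℍ) :
    ∃ (ε : ℝ) (ψ₀ : ℂ → ℂ), 0 < ε ∧
      DifferentiableOn ℂ ψ₀ (ball ((((16 : ℝ) ^ ((N : ℝ)⁻¹) : ℝ) : ℂ) * modularLambdaRoot N τ₀) ε) ∧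
      ψ₀ ((((16 : ℝ) ^ ((N : ℝ)⁻¹) : ℝ) : ℂ) * modularLambdaRoot N τ₀) = τ₀ ∧
      ∀ w ∈ ball ((((16 : ℝ) ^ ((N : ℝ)⁻¹) : ℝ) : ℂ) * modularLambdaRoot N τ₀) ε,
        ∃ hw : 0 < (ψ₀ w).im,
          (((16 : ℝ) ^ ((N : ℝ)⁻¹) : ℝ) : ℂ) * modularLambdaRoot N ⟨ψ₀ w, hw⟩ = w := by
  set c : ℂ := (((16 : ℝ) ^ ((N : ℝ)⁻¹) : ℝ) : ℂ) with hc
  have hc0 : c ≠ 0 := by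
    rw [hc]; exact_mod_cast (by positivity : (0 : ℝ) < (16 : ℝ) ^ ((N : ℝ)⁻¹)).ne'
  -- `X = x̂ ∘ ofComplex` on `ℂ`
  set X : ℂ → ℂ := fun z ↦ c * modularLambdaRoot N (ofComplex z) with hX
  have hXd : DifferentiableOn ℂ X {z : ℂ | 0 < z.im} :=
    (differentiableOn_modularLambdaRoot_comp_ofComplex N).const_mul c
  -- injectivity of `X` on a neighbourhood of `τ₀` (local homeomorphism)
  obtain ⟨e, hτ₀e, hxe⟩ := isLocalHomeomorph_modularLambdaRoot hN τ₀
  set V : Set ℂ := ((↑) : ℍ → ℂ) '' e.source with hV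
  have hVopen : IsOpen V := UpperHalfPlane.isOpenEmbedding_coe.isOpenMap _ e.open_source
  have hVsub : V ⊆ {z : ℂ | 0 < z.im} := by
    rintro _ ⟨τ, -, rfl⟩; exact τ.im_pos
  have hτ₀V : (τ₀ : ℂ) ∈ V := ⟨τ₀, hτ₀e, rfl⟩
  have hinj : InjOn X V := by
    rintro _ ⟨τ₁, h₁, rfl⟩ _ ⟨τ₂, h₂, rfl⟩ h12
    simp only [hX, ofComplex_apply] at h12
    have h12' : modularLambdaRoot N τ₁ = modularLambdaRoot N τ₂ := mul_left_cancel₀ hc0 h12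
    have : (e τ₁ : ℂ) = e τ₂ := by rw [← hxe]; exact h12'
    rw [e.injOn h₁ h₂ this]
  have hX' : deriv X τ₀ ≠ 0 := SCV.deriv_ne_zero_of_injOn (hXd.mono hVsub) hVopen hinj hτ₀V
  have hXan : AnalyticAt ℂ X τ₀ := hXd.analyticAt (isOpen_upperHalfPlaneSet.mem_nhds τ₀.im_pos)
  -- the local inverse
  set ψ₀ : ℂ → ℂ := hXan.hasStrictDerivAt.localInverse X (deriv X τ₀) τ₀ hX' with hψ₀
  have hψan : AnalyticAt ℂ ψ₀ (X τ₀) := hXan.analyticAt_localInverse hX'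
  have hright : ∀ᶠ w in 𝓝 (X τ₀), X (ψ₀ w) = w := hXan.hasStrictDerivAt.eventually_right_inverse hX'
  have hψτ₀ : ψ₀ (X τ₀) = τ₀ :=
    HasStrictFDerivAt.localInverse_apply_image (hXan.hasStrictDerivAt.hasStrictFDerivAt_equiv hX')
  have hXτ₀ : X τ₀ = c * modularLambdaRoot N τ₀ := by simp [hX, ofComplex_apply]
  have hψt : Tendsto ψ₀ (𝓝 (X τ₀)) (𝓝 (τ₀ : ℂ)) := by
    have h := hψan.continuousAt.tendsto
    rwa [hψτ₀] at h
  have him : ∀ᶠ w in 𝓝 (X τ₀), 0 < (ψ₀ w).im :=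
    hψt.eventually (isOpen_upperHalfPlaneSet.mem_nhds τ₀.im_pos)
  obtain ⟨U, hUn, hUan⟩ := hψan.exists_mem_nhds_analyticOnNhd
  obtain ⟨ε, hε, hball⟩ := Metric.mem_nhds_iff.mp (Filter.inter_mem hUn (Filter.inter_mem hright him))
  refine ⟨ε, ψ₀, hε, ?_, ?_, ?_⟩
  · rw [← hXτ₀]
    exact fun w hw ↦ (hUan w (hball hw).1).differentiableAt.differentiableWithinAt
  · rw [← hXτ₀]; exact hψτ₀
  · intro w hw
    rw [← hXτ₀] at hw
    obtain ⟨-, hr, hi⟩ := hball hw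
    refine ⟨hi, ?_⟩
    have : X (ψ₀ w) = c * modularLambdaRoot N ⟨ψ₀ w, hi⟩ := by
      simp only [hX, ofComplex_apply_of_im_pos hi]
    rw [← this, hr]

end Literature.Analysis.Complex

end
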